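import Literature.Barriers.NavierStokesRegularity.NavierStokesInequalityCantorArrangement
import Literature.Barriers.NavierStokesRegularity.NavierStokesInequalityInteractionStack
import Literature.Barriers.NavierStokesRegularity.NavierStokesInequalityCantorBackground
import Literature.Barriers.NavierStokesRegularity.NavierStokesInequalityStructureCompactness
import HarnessLib

/-!
# The geometric arrangement for Theorem 14: assembly (Ożański 2017, §6.5; Scheffer 1987, §4)

Barrier catalogue support file for `NavierStokesRegularity` (D-0021): the discharge of fact C′
`Literature.Barriers.NavierStokesRegularity.NSICantorArrangementExists` of
`NavierStokesInequalityCantorArrangement` **modulo the two cut-off facts** of Ożański's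
Theorem 3.4 (`Ozanski2017_cutoff_rect`, `Ozanski2017_cutoff_ring` of
`NavierStokesInequalityStructureRecipe`, the only unproved inputs):
`nsiCantorArrangementExists_of_cutoffs`. The construction is W. S. Ożański, arXiv:1709.00602v4,
§6.5 Steps 1–6 over §5, with the bricks

* `NavierStokesInequalityStructureCopies` (copies, sums, (5.11), (5.26)),
* `NavierStokesInequalityInteractionStack` (the base field (5.1)–(5.3), parity (5.4), Lemma 3.5 (iv),
  the stack `H` with §5.2 (i)–(vi)),
* `NavierStokesInequalityRingField` (Lemma 5.2, the field `v₂`),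
* `NavierStokesInequalityCantorBackground` (Lemma 5.3/13, Lemma 6.18, `H*`),
* `NavierStokesInequalityInteractionDecay` (Lemma 3.5 (i), (ii), (iii), (v)),
* `NavierStokesInequalityStructureRecipe` (the recipe, Theorem 3.4 as the two facts).

## Contents

* `clusterSet/Vec/Fun`, `IsNSIStructure.clusters`: the `M` translated clusters (§6.5 Step 2) form a
  structure with interaction function `H*` (`hstar`); `IsNSIStructure.clusters_add_background`:
  adding the background copy `U^{a,r}` (Step 4) gives the first structure `(v₁,f₁,φ₁)` on `U₁`
  with `F[v₁,f₁] = H* + F^{a,r,s}`.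
* `pairwise_disjoint_images`, `meridian_image`: Step 5 (the images `Γ_n(G)` through their axial
  coordinates; `R⁻¹(τR(BOX) + z) ⊆ SBOX`).
* `inner_ge`: Step 4, `v₂·F* ≥ -1.12ε²B` on the carrier of `v₂`; `sq_lt_of_inner`: (6.6);
  `gain_case_one`, `gain_case_two`: the two cases of (6.7) (= (5.29)).
* `exists_parameters`: the choice of `ε` (through `m ∈ ℕ`, `ε = κE/(4Xm)`, `M = m + 1`) with all
  the smallness conditions (5.14), (6.35)–(6.36) and `τ^ξ M ≥ 1`.
* `nsiCantorArrangementExists_of_cutoffs` (and the corollary `nsiCantorBlockExists_of_cutoffs`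
  through the assembly of `NavierStokesInequalityCantorArrangement`).

Constants: the printed `-1.1ε²B` of Step 4 becomes `-1.12ε²B` (the tree's Lemma 5.2 has
`v_z ≥ -1.04ε²`, `|v_r| ≤ Kε`), absorbed by `T = (μ² - 5)/(1.12ε²B)` and
`κ = 10⁴ max(1,K) max(1,C/D)` (printed `κ = 10⁴C/D`); all printed inequalities of Steps 5–6 then
hold with room to spare (`8/1.12 · 0.2304 > 1.0201`, `0.01/1.12 · 0.2304 > 10⁻⁴`).

## References

* W. S. Ożański, arXiv:1709.00602v4 (2017/2019), §5.3–§5.5 ((5.14)–(5.31)), §6.5 Steps 1–6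
  ((6.33)–(6.36), Lemma 6.18). [`Ozanski2017NSISingular`]
* V. Scheffer, Comm. Math. Phys. 110 (1987), 525–551, §4 (Lemmas 4.1–4.18), §5 ((5.1)–(5.7),
  (5.19)–(5.25)). [`Scheffer1987`]
-/

noncomputable section

open MeasureTheory Set Function Filter Topology TopologicalSpace WithLp Metric Real
open scoped ENNReal InnerProductSpace RealInnerProductSpace ContDiff

namespace Literature.Barriers.NavierStokesRegularity

open Literature.Analysis.FluidPDE Literature.Analysis.Calculus

/-- Local notation for physical space `ℝ³ = EuclideanSpace ℝ (Fin 3)`. -/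
local notation "ℝ³" => EuclideanSpace ℝ (Fin 3)

/-! ### The `M` translated clusters (§6.5 Step 2) -/

/-- The union `⋃_{n<M} (cluster + nX)` of the translated clusters (Ożański (6.34)).
[cite: Ozanski2017NSISingular, §6.5 Step 2] -/
def clusterSet (Uc : Set (ℝ × ℝ)) (M : ℕ) (X : ℝ) : Set (ℝ × ℝ) :=
  ⋃ n ∈ Finset.range M, copySet (n * X) 1 Uc

/-- The field `Σ_{n<M} v_c(· - nX)` of the translated clusters. [cite: Ozanski2017NSISingular, §6.5 Step 4] -/
def clusterVec (vc : ℝ × ℝ → ℝ × ℝ) (M : ℕ) (X : ℝ) : ℝ × ℝ → ℝ × ℝ :=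
  ∑ n ∈ Finset.range M, copyVec (n * X) 1 1 vc

/-- The scalar `Σ_{n<M} g(· - nX)` of the translated clusters. [cite: Ozanski2017NSISingular, §6.5 Step 4] -/
def clusterFun (g : ℝ × ℝ → ℝ) (M : ℕ) (X : ℝ) : ℝ × ℝ → ℝ :=
  ∑ n ∈ Finset.range M, copyFun (n * X) 1 1 g

section Clusters

variable {Uc : Set (ℝ × ℝ)} {vc : ℝ × ℝ → ℝ × ℝ} {fc φc : ℝ × ℝ → ℝ}

/-- A translate `U^{nX,1}` of a cluster with `Ū_c ⊆ {ρ₀ ≤ r ≤ ρ₁} × {|z| ≤ Z₀}` has closure in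
`{ρ₀ ≤ r ≤ ρ₁} × {|z - nX| ≤ Z₀}`. [folklore] -/
theorem closure_translate_subset {ρ₀ ρ₁ Z₀ : ℝ}
    (hcl : ∀ q ∈ closure Uc, (ρ₀ ≤ q.1 ∧ q.1 ≤ ρ₁) ∧ |q.2| ≤ Z₀) (c : ℝ) {q : ℝ × ℝ}
    (hq : q ∈ closure (copySet c 1 Uc)) : (ρ₀ ≤ q.1 ∧ q.1 ≤ ρ₁) ∧ |q.2 - c| ≤ Z₀ := by
  rw [closure_copySet c one_ne_zero] at hq
  have h := hcl _ hq
  simpa using h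

/-- **The translated clusters form a structure whose interaction function is `H*`** (Ożański 2017,
§6.5 Step 2 and Step 4: "`H*` is the pressure interaction function corresponding to
`⋃ₙ (U^{nX} ∪ U^{a'+nX,r'} ∪ U^{a''+nX,r''})`"), provided `X > 2Z₀` separates them.
[cite: Ozanski2017NSISingular, §6.5 Steps 2 and 4] -/
theorem IsNSIStructure.clusters (hc : IsNSIStructure Uc vc fc φc) {ρ₀ ρ₁ Z₀ X : ℝ}
    (hcl : ∀ q ∈ closure Uc, (ρ₀ ≤ q.1 ∧ q.1 ≤ ρ₁) ∧ |q.2| ≤ Z₀) (hX : 2 * Z₀ < X) (M : ℕ) :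
    IsNSIStructure (clusterSet Uc M X) (clusterVec vc M X) (clusterFun fc M X) (clusterFun φc M X) ∧
      pressureInteraction (clusterVec vc M X) (clusterFun fc M X) = hstar (pressureInteraction vc fc) M X ∧
      (∀ q ∈ closure (clusterSet Uc M X), (ρ₀ ≤ q.1 ∧ q.1 ≤ ρ₁) ∧
        ∃ n ∈ Finset.range M, |q.2 - n * X| ≤ Z₀) := by
  have hcopy : ∀ n ∈ Finset.range M, IsNSIStructure (copySet (n * X) 1 Uc) (copyVec (n * X) 1 1 vc)
      (copyFun (n * X) 1 1 fc) (copyFun (n * X) 1 1 φc) := fun n _ => hc.copy (n * X) one_pos one_pos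
  have hdisj : ((Finset.range M : Finset ℕ) : Set ℕ).Pairwise fun i j =>
      Disjoint (closure (copySet (i * X) 1 Uc)) (closure (copySet (j * X) 1 Uc)) := by
    intro i _ j _ hij
    refine disjoint_left.2 fun q hqi hqj => ?_
    have hi := (closure_translate_subset hcl (i * X) hqi).2
    have hj := (closure_translate_subset hcl (j * X) hqj).2
    have hij' : (1 : ℝ) ≤ |(i : ℝ) - j| := by
      have : (1 : ℤ) ≤ |(i : ℤ) - j| := Int.one_le_abs (sub_ne_zero.2 (by exact_mod_cast hij))
      exact_mod_cast this
    have hZ : 0 ≤ Z₀ := (abs_nonneg _).trans hi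
    have hXpos : 0 < X := by linarith
    have h1 : |(i : ℝ) * X - j * X| ≤ 2 * Z₀ := by
      have := abs_sub_le ((i : ℝ) * X) q.2 (j * X)
      rw [abs_sub_comm] at hi
      linarith
    rw [← sub_mul, abs_mul, abs_of_pos hXpos] at h1
    have h2 : X ≤ |(i : ℝ) - j| * X := by nlinarith
    linarith
  have hst := IsNSIStructure.finsetSum (Finset.range M) hcopy hdisj
  refine ⟨hst, ?_, fun q hq => ?_⟩
  · rw [clusterVec, clusterFun, IsNSIStructure.pressureInteraction_finsetSum (Finset.range M) hcopy hdisj]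
    funext q
    rw [hstar, Finset.sum_apply]
    refine Finset.sum_congr rfl fun n _ => ?_
    rw [hc.pressureInteraction_copy (n * X) one_pos zero_le_one]
    simp
  · rw [clusterSet, Finset.closure_biUnion] at hq
    simp only [mem_iUnion] at hq
    obtain ⟨n, hn, hqn⟩ := hq
    have h := closure_translate_subset hcl (n * X) hqn
    exact ⟨h.1, n, hn, h.2⟩

end Clusters

/-! ### The first structure: clusters plus the background copy (§6.5 Step 4) -/

section First

variable {Uc U₀ : Set (ℝ × ℝ)} {vc v₀ : ℝ × ℝ → ℝ × ℝ} {fc φc f₀ φ₀ : ℝ × ℝ → ℝ}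

/-- **`(v₁,f₁,φ₁)` on `U₁ = ⋃ₙ clusters ∪ U^{a,r}` is a structure with
`F[v₁,f₁] = H* + F^{a,r,s}`** (Ożański 2017, §6.5 Step 4, (6.37)–(6.38)), provided the background
copy lies to the left of all clusters (`a + r < -Z₀`). [cite: Ozanski2017NSISingular, §6.5 Step 4] -/
theorem IsNSIStructure.clusters_add_background (hc : IsNSIStructure Uc vc fc φc)
    (h₀ : IsNSIStructure U₀ v₀ f₀ φ₀) {ρ₀ ρ₁ Z₀ X : ℝ}
    (hcl : ∀ q ∈ closure Uc, (ρ₀ ≤ q.1 ∧ q.1 ≤ ρ₁) ∧ |q.2| ≤ Z₀) (hX : 2 * Z₀ < X) (M : ℕ)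
    (hU₀ : ∀ q ∈ closure U₀, ((1 : ℝ) / 8 ≤ q.1 ∧ q.1 ≤ 7 / 8) ∧ |q.2| ≤ 1) {a r s : ℝ} (hr : 0 < r)
    (hs : 0 < s) (har : a + r < -Z₀) :
    IsNSIStructure (clusterSet Uc M X ∪ copySet a r U₀) (clusterVec vc M X + copyVec a r s v₀)
        (clusterFun fc M X + copyFun a r s f₀) (clusterFun φc M X + copyFun a r 1 φ₀) ∧
      pressureInteraction (clusterVec vc M X + copyVec a r s v₀) (clusterFun fc M X + copyFun a r s f₀) =
        (fun q => hstar (pressureInteraction vc fc) M X q +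
          (s ^ 2 / r) • pressureInteraction v₀ f₀ (copyInv a r q)) ∧
      (∀ q ∈ closure (copySet a r U₀), (r / 8 ≤ q.1 ∧ q.1 ≤ 7 * r / 8) ∧ (a - r ≤ q.2 ∧ q.2 ≤ a + r)) := by
  obtain ⟨hcs, hF, hccl⟩ := hc.clusters hcl hX M
  have hb := h₀.copy a hr hs
  have hbcl : ∀ q ∈ closure (copySet a r U₀), (r / 8 ≤ q.1 ∧ q.1 ≤ 7 * r / 8) ∧ (a - r ≤ q.2 ∧ q.2 ≤ a + r) := by
    intro q hq
    rw [closure_copySet a hr.ne'] at hq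
    have h := hU₀ _ hq
    simp only [copyInv_apply] at h
    obtain ⟨⟨h1, h2⟩, h3⟩ := h
    rw [le_div_iff₀ hr] at h1
    rw [div_le_iff₀ hr] at h2
    rw [abs_div, abs_of_pos hr, div_le_one hr, abs_le] at h3
    exact ⟨⟨by linarith, by linarith⟩, by linarith [h3.1], by linarith [h3.2]⟩
  have hdisj : Disjoint (closure (clusterSet Uc M X)) (closure (copySet a r U₀)) := by
    refine disjoint_left.2 fun q hq hq' => ?_
    obtain ⟨-, n, -, hn⟩ := hccl q hq
    have hZ : 0 ≤ Z₀ := (abs_nonneg _).trans hn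
    have h1 : -Z₀ ≤ q.2 := by
      have := (abs_le.1 hn).1
      have hnX : (0 : ℝ) ≤ n * X := mul_nonneg (Nat.cast_nonneg n) (by linarith)
      linarith
    have h2 := (hbcl q hq').2.2
    linarith
  refine ⟨hcs.add hb hdisj, ?_, hbcl⟩
  rw [hcs.pressureInteraction_add hb hdisj, hF, h₀.pressureInteraction_copy a hr hs.le]
  rfl

end First

/-! ### Step 5: the images `Γ_n(G)` -/

section Images

/-- **Pairwise disjointness of the `Γ_n(G)` through the axial coordinate** (Ożański 2017, §6.5
Step 5): if every point of `G` has axial coordinate in `[-d, d]` (the box) or in `[a-r, a+r]` (the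
background copy), the images `Γ_n(G) = τG + z + nX x̂₂` have axial coordinates in
`Iₙ = [z₂+nX-τd, z₂+nX+τd]` or `Jₙ = [z₂+nX+τ(a-r), z₂+nX+τ(a+r)]`; these `2M` intervals are pairwise
disjoint as soon as `2τd < X`, `2τr < X` and all `Jₙ` lie left of all `Iₙ`.
[cite: Ozanski2017NSISingular, §6.5 Step 5] -/
theorem pairwise_disjoint_images {S : Set ℝ³} {d a r τ X : ℝ} {M : ℕ} (hτ : 0 < τ) (hX : 0 < X)
    (hS : ∀ x ∈ S, |x 2| ≤ d ∨ (a - r ≤ x 2 ∧ x 2 ≤ a + r)) (h1 : 2 * (τ * d) < X) (h2 : 2 * (τ * r) < X)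
    (h3 : ((M : ℝ) - 1) * X + τ * (a + r) < -(τ * d)) (z : ℝ³) :
    Pairwise fun n n' : Fin M =>
      Disjoint ((fun x : ℝ³ => τ • x + cantorTranslate X z M n) '' S)
        ((fun x : ℝ³ => τ • x + cantorTranslate X z M n') '' S) := by
  intro n n' hnn'
  refine disjoint_left.2 ?_
  rintro y ⟨x, hx, rfl⟩ ⟨x', hx', hy⟩
  have h2c : ∀ (w : ℝ³) (k : Fin M), (τ • w + cantorTranslate X z M k) 2 = τ * w 2 + z 2 + (k : ℕ) * X := by
    intro w k
    simp [cantorTranslate]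
    ring
  have key := congrArg (fun w : ℝ³ => w 2) hy
  simp only [h2c] at key
  -- `key : τ x'₂ + z₂ + n'X = τ x₂ + z₂ + nX`
  have hne : (n : ℕ) ≠ (n' : ℕ) := fun h => hnn' (Fin.ext h)
  have hgap : (1 : ℝ) ≤ |((n : ℕ) : ℝ) - (n' : ℕ)| := by
    have : (1 : ℤ) ≤ |((n : ℕ) : ℤ) - (n' : ℕ)| := Int.one_le_abs (sub_ne_zero.2 (by exact_mod_cast hne))
    exact_mod_cast this
  have hMn : ((n : ℕ) : ℝ) ≤ (M : ℝ) - 1 := by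
    have h := n.isLt
    have : ((n : ℕ) : ℝ) + 1 ≤ M := by exact_mod_cast h
    linarith
  have hMn' : ((n' : ℕ) : ℝ) ≤ (M : ℝ) - 1 := by
    have h := n'.isLt
    have : ((n' : ℕ) : ℝ) + 1 ≤ M := by exact_mod_cast h
    linarith
  have hn0 : (0 : ℝ) ≤ (n : ℕ) := Nat.cast_nonneg _
  have hn0' : (0 : ℝ) ≤ (n' : ℕ) := Nat.cast_nonneg _
  have hdiff : ((n : ℕ) : ℝ) * X - (n' : ℕ) * X = τ * (x' 2 - x 2) := by linarith
  -- when both points are in the same piece, `|n - n'| X = τ |x'₂ - x₂|` is too small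
  have same : ∀ {w : ℝ}, |x' 2 - x 2| ≤ 2 * w → 2 * (τ * w) < X → False := by
    intro w hw hwX
    have hge : X ≤ |((n : ℕ) : ℝ) * X - (n' : ℕ) * X| := by
      rw [← sub_mul, abs_mul, abs_of_pos hX]; nlinarith
    rw [hdiff, abs_mul, abs_of_pos hτ] at hge
    nlinarith [abs_nonneg (x' 2 - x 2)]
  rcases hS x hx with hxd | hxa <;> rcases hS x' hx' with hx'd | hx'a
  · refine same (w := d) ?_ h1
    rw [abs_le]; constructor <;> linarith [(abs_le.1 hxd).1, (abs_le.1 hxd).2, (abs_le.1 hx'd).1, (abs_le.1 hx'd).2]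
  · -- `x` in the box, `x'` in the background: `J_{n'}` is left of `I_n`
    have e1 : τ * x' 2 ≤ τ * (a + r) := mul_le_mul_of_nonneg_left hx'a.2 hτ.le
    have e2 : ((n' : ℕ) : ℝ) * X ≤ ((M : ℝ) - 1) * X := mul_le_mul_of_nonneg_right hMn' hX.le
    have e3 : -(τ * d) ≤ τ * x 2 := by nlinarith [(abs_le.1 hxd).1]
    have e4 : (0 : ℝ) ≤ (n : ℕ) * X := mul_nonneg hn0 hX.le
    linarith
  · have e1 : τ * x 2 ≤ τ * (a + r) := mul_le_mul_of_nonneg_left hxa.2 hτ.le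
    have e2 : ((n : ℕ) : ℝ) * X ≤ ((M : ℝ) - 1) * X := mul_le_mul_of_nonneg_right hMn hX.le
    have e3 : -(τ * d) ≤ τ * x' 2 := by nlinarith [(abs_le.1 hx'd).1]
    have e4 : (0 : ℝ) ≤ (n' : ℕ) * X := mul_nonneg hn0' hX.le
    linarith
  · refine same (w := r) ?_ h2
    rw [abs_le]; constructor <;> linarith [hxa.1, hxa.2, hx'a.1, hx'a.2]

/-- **The meridian coordinates of `Γ_n x`**: for `z = (εr/2, 0, z₂)` and `x` at distance `ρ` from the
axis, the distance of `τx + z + nX x̂₂` to the axis is within `τρ` of `εr/2`, and its axial coordinate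
is `τ x₂ + z₂ + nX` (Ożański (5.21), §6.5 Step 5). [cite: Ozanski2017NSISingular, §5.3 (5.21) and §6.5 Step 5] -/
theorem meridian_image {τ ρz z₂ X : ℝ} (hτ : 0 < τ) (hρz : 0 ≤ ρz) (x : ℝ³) (M : ℕ) (n : Fin M) :
    |(meridian (τ • x + cantorTranslate X (meridianPoint (ρz, z₂)) M n)).1 - ρz| ≤ τ * cylRadius x ∧
      (meridian (τ • x + cantorTranslate X (meridianPoint (ρz, z₂)) M n)).2 = τ * x 2 + z₂ + (n : ℕ) * X := by
  constructor
  · rw [meridian_apply]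
    simp only [cantorTranslate_apply]
    rw [← add_assoc, show EuclideanSpace.single (2 : Fin 3) (1 : ℝ) = EuclideanSpace.single 2 1 from rfl,
      cylRadius_add_smul_single_two]
    have h := abs_cylRadius_add_sub_le (τ • x) (meridianPoint (ρz, z₂))
    have hz : cylRadius (meridianPoint (ρz, z₂)) = ρz := by
      have := meridian_meridianPoint (q := (ρz, z₂)) hρz
      exact congrArg Prod.fst this
    rw [hz, cylRadius_smul, abs_of_pos hτ] at h
    exact h
  · simp [cantorTranslate, meridianPoint]
    ring

end Images

/-! ### Step 4: `v₂ · F* ≥ -1.12 ε² B` on the support of `v₂` -/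

section Inner

/-- **§6.5 Step 4 (Cases 1–2): `v₂·F* ≥ -1.12ε²B` on the carrier of `v₂`** (printed `-1.1εB`,
in fact `-1.1ε²B`; here `1.12` because the ring field of `NavierStokesInequalityRingField` has
`v_z ≥ -1.04ε²` in place of `-ε²`). Inputs: the ring-field bounds (Lemma 5.2 (iii)), membership in
the carrier, `H*₁ ≥ -1.02B` on the strip (Step 2 (i)), `|H*| ≤ Bε²/100` at distance `≥ r/10` from the
cluster axis points (Case 2 with (6.36)), the background bounds (Lemma 5.3) on `BOX`, `(M-1)X = d/4`.
[cite: Ozanski2017NSISingular, §6.5 Step 4] -/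
theorem inner_ge {w F Hs Fb : ℝ × ℝ → ℝ × ℝ} {ε r d B K' X : ℝ} {M : ℕ} (hε : 0 < ε) (hε20 : ε ≤ 1 / 20)
    (hr : 0 < r) (hd : 4 * r ≤ d) (hB : 0 < B) (hK'1 : 1 ≤ K') (hK'ε : K' * ε ≤ 96 / 100) (hX : 0 < X)
    (hMX : ((M : ℝ) - 1) * X = d / 4) (hF : ∀ p, F p = Hs p + Fb p)
    (hw1 : ∀ p : ℝ × ℝ, |p.2| ≤ d - r → (w p).1 = 0) (hw2 : ∀ p : ℝ × ℝ, p.1 ≤ 11 * r / 100 → 0 ≤ (w p).2)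
    (hw3 : ∀ p : ℝ × ℝ, (w p).2 ∈ Set.Icc (-(104 / 100 * ε ^ 2)) 1) (hw4 : ∀ p : ℝ × ℝ, |(w p).1| ≤ K' * ε)
    (hs1 : ∀ p : ℝ × ℝ, 0 ≤ p.1 → p.1 < ε * r → -(102 / 100) * B ≤ (Hs p).2)
    (hs2 : ∀ p : ℝ × ℝ, (∀ n ∈ Finset.range M, r / 10 ≤ ‖(p.1, p.2 - n * X)‖) → ‖Hs p‖ ≤ B * ε ^ 2 / 100)
    (hb : ∀ p : ℝ × ℝ, 0 ≤ p.1 → p.1 ≤ 99 / 100 * r → |p.2| ≤ d →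
      (Fb p).2 ∈ Set.Icc (103 / 100 * B) (105 / 100 * B) ∧ |(Fb p).1| ≤ 34 * ε * B / (10 ^ 4 * K'))
    {q : ℝ × ℝ} (hq : q ∈ RingField.carrier ε r d) :
    -(112 / 100 * ε ^ 2 * B) ≤ (w q).1 * (F q).1 + (w q).2 * (F q).2 := by
  have hεr : 0 < ε * r := mul_pos hε hr
  -- coordinates of a carrier point
  have hq1 : ε * r / 100 ≤ q.1 ∧ q.1 ≤ 99 / 100 * r := by
    rcases hq with ⟨⟨h1, h2⟩, -⟩ | ⟨h1 | h1, -⟩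
    · exact ⟨h1, by linarith⟩
    · exact ⟨h1.1, by nlinarith [h1.2]⟩
    · exact ⟨by nlinarith [h1.1], by linarith [h1.2]⟩
  have hq2 : |q.2| ≤ d - r / 10 := by
    rcases hq with ⟨-, -, h4⟩ | ⟨-, h3, h4⟩
    · exact h4
    · rw [abs_le]; exact ⟨by linarith, h4⟩
  have hq0 : 0 ≤ q.1 := by linarith [hq1.1]
  obtain ⟨hFb2, hFb1⟩ := hb q hq0 hq1.2 (by linarith)
  rw [hF q]
  simp only [Prod.fst_add, Prod.snd_add]
  by_cases hA : q.1 < ε * r ∧ |q.2| ≤ d - r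
  · -- Case 1: in the strip and inside `RECT`: `v_r = 0`, `v_z ≥ 0`, `F*₁ > 0`
    have h1 : (w q).1 = 0 := hw1 q hA.2
    have h2 : 0 ≤ (w q).2 := hw2 q (by nlinarith [hA.1])
    have h3 : -(102 / 100) * B ≤ (Hs q).2 := hs1 q hq0 hA.1
    have h4 : 0 ≤ (Hs q).2 + (Fb q).2 := by linarith [hFb2.1]
    rw [h1, zero_mul, zero_add]
    have := mul_nonneg h2 h4
    nlinarith [sq_nonneg ε]
  · -- Case 2: far from the cluster axis points
    have hfar : ∀ n ∈ Finset.range M, r / 10 ≤ ‖(q.1, q.2 - n * X)‖ := by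
      intro n hn
      have hnX : (0 : ℝ) ≤ n * X ∧ (n : ℝ) * X ≤ d / 4 := by
        have hn' : (n : ℝ) ≤ (M : ℝ) - 1 := by
          have := Finset.mem_range.1 hn
          have : (n : ℝ) + 1 ≤ M := by exact_mod_cast this
          linarith
        exact ⟨mul_nonneg (Nat.cast_nonneg n) hX.le, by nlinarith⟩
      rw [Prod.norm_def, Real.norm_eq_abs, Real.norm_eq_abs]
      -- either the radial coordinate is `≥ 0.11 r`, or the axial one is beyond `d - r`
      rcases hq with ⟨⟨-, -⟩, h3, -⟩ | ⟨h1 | h1, h3⟩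
      · refine le_max_of_le_right ?_
        have : |q.2| - n * X ≤ |q.2 - n * X| := by
          have := abs_sub_abs_le_abs_sub q.2 (n * X); rw [abs_of_nonneg hnX.1] at this; exact this
        linarith
      · have hz : d - r < |q.2| := by
          by_contra hz; exact hA ⟨by linarith [h1.2], not_lt.1 hz⟩
        refine le_max_of_le_right ?_
        have : |q.2| - n * X ≤ |q.2 - n * X| := by
          have := abs_sub_abs_le_abs_sub q.2 (n * X); rw [abs_of_nonneg hnX.1] at this; exact this
        linarith
      · exact le_max_of_le_left (by rw [abs_of_nonneg hq0]; linarith [h1.1])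
    have hHs := hs2 q hfar
    have hHs1 : |(Hs q).1| ≤ B * ε ^ 2 / 100 :=
      le_trans (by rw [← Real.norm_eq_abs]; exact norm_fst_le (Hs q)) hHs
    have hHs2 : |(Hs q).2| ≤ B * ε ^ 2 / 100 :=
      le_trans (by rw [← Real.norm_eq_abs]; exact norm_snd_le (Hs q)) hHs
    have hw1q := hw4 q
    have hw2q := hw3 q
    have hε2 : 104 / 100 * ε ^ 2 ≤ 1 := by nlinarith
    have hw2abs : |(w q).2| ≤ 1 := abs_le.2 ⟨by linarith [hw2q.1], hw2q.2⟩
    -- the four products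
    have p1 : -(96 / 100 * (B * ε ^ 2 / 100)) ≤ (w q).1 * (Hs q).1 := by
      have h1 : |(w q).1 * (Hs q).1| ≤ 96 / 100 * (B * ε ^ 2 / 100) := by
        rw [abs_mul]; exact mul_le_mul (hw1q.trans hK'ε) hHs1 (abs_nonneg _) (by norm_num)
      linarith [neg_abs_le ((w q).1 * (Hs q).1)]
    have p2 : -(K' * ε * (34 * ε * B / (10 ^ 4 * K'))) ≤ (w q).1 * (Fb q).1 := by
      have h1 : |(w q).1 * (Fb q).1| ≤ K' * ε * (34 * ε * B / (10 ^ 4 * K')) := by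
        rw [abs_mul]; exact mul_le_mul hw1q hFb1 (abs_nonneg _) (by positivity)
      linarith [neg_abs_le ((w q).1 * (Fb q).1)]
    have p2' : K' * ε * (34 * ε * B / (10 ^ 4 * K')) = 34 / 10 ^ 4 * ε ^ 2 * B := by
      field_simp
    have p3 : -(1 * (B * ε ^ 2 / 100)) ≤ (w q).2 * (Hs q).2 := by
      have h1 : |(w q).2 * (Hs q).2| ≤ 1 * (B * ε ^ 2 / 100) := by
        rw [abs_mul]; exact mul_le_mul hw2abs hHs2 (abs_nonneg _) (by norm_num)
      linarith [neg_abs_le ((w q).2 * (Hs q).2)]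
    have p4 : -(104 / 100 * ε ^ 2 * (105 / 100 * B)) ≤ (w q).2 * (Fb q).2 := by
      rcases le_or_gt 0 ((w q).2) with h | h
      · have := mul_nonneg h (by linarith [hFb2.1] : 0 ≤ (Fb q).2); nlinarith [sq_nonneg ε]
      · nlinarith [hw2q.1, hFb2.1, hFb2.2]
    rw [p2'] at p2
    nlinarith [p1, p2, p3, p4]

/-- **(6.6) from Step 4**: `f₂² + T v₂·F* > |v₂|²` in `U₂` — on `supp v₂`, `f₂ = μ` and
`μ² + T(v₂·F*) ≥ μ² - 1.12ε²BT = 5 > |v₂|²`; off it, `v₂ = 0 < f₂`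
(Ożański (5.28), with `T = (μ² - 5)/(1.12ε²B)`). [cite: Ozanski2017NSISingular, §5.5 (5.28) and §6.5 Step 6] -/
theorem sq_lt_of_inner {w F : ℝ × ℝ → ℝ × ℝ} {f₂ : ℝ × ℝ → ℝ} {μ T ε B K' : ℝ} {q : ℝ × ℝ}
    (hinner : q ∈ tsupport w → -(112 / 100 * ε ^ 2 * B) ≤ (w q).1 * (F q).1 + (w q).2 * (F q).2)
    (hf₂μ : q ∈ tsupport w → f₂ q = μ) (hf₂pos : 0 < f₂ q)
    (hw3 : (w q).2 ∈ Set.Icc (-(104 / 100 * ε ^ 2)) 1) (hw4 : |(w q).1| ≤ K' * ε) (hε20 : ε ≤ 1 / 20)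
    (hε : 0 < ε) (hK'ε : K' * ε ≤ 96 / 100) (hT : T * (112 / 100 * ε ^ 2 * B) = μ ^ 2 - 5) (hT0 : 0 ≤ T) :
    (w q).1 ^ 2 + (w q).2 ^ 2 < f₂ q ^ 2 + T * ((w q).1 * (F q).1 + (w q).2 * (F q).2) := by
  by_cases hq : q ∈ tsupport w
  · have h1 := hinner hq
    rw [hf₂μ hq]
    have hw1 : (w q).1 ^ 2 ≤ (96 / 100) ^ 2 := by
      have : |(w q).1| ≤ 96 / 100 := hw4.trans hK'ε
      nlinarith [abs_nonneg ((w q).1), sq_abs ((w q).1)]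
    have hw2 : (w q).2 ^ 2 ≤ 1 := by
      have hε2 : 104 / 100 * ε ^ 2 ≤ 1 := by nlinarith
      have : |(w q).2| ≤ 1 := abs_le.2 ⟨by linarith [hw3.1], hw3.2⟩
      nlinarith [abs_nonneg ((w q).2), sq_abs ((w q).2)]
    have h2 : T * (-(112 / 100 * ε ^ 2 * B)) ≤ T * ((w q).1 * (F q).1 + (w q).2 * (F q).2) :=
      mul_le_mul_of_nonneg_left h1 hT0
    nlinarith
  · have h0 : w q = 0 := image_eq_zero_of_notMem_tsupport hq
    simp only [h0, Prod.fst_zero, Prod.snd_zero, zero_mul, add_zero, mul_zero, ne_eq, OfNat.ofNat_ne_zero,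
      not_false_eq_true, zero_pow]
    positivity

end Inner

/-! ### Step 6: the two cases of (6.7) -/

section Gain

/-- **(6.7), Case 1** (Ożański (5.29) Case 1: `8TB ≥ (7.2/1.1)(μ/ε)² > (1.01/0.48)²(μ/ε)²`; here with
`1.12` in `T`): if `F*₁(y) ≥ 8B`, `v₂(y) = (0,1)`, `f₁ ≤ μ/100`, `f₂ ≤ μ`, then
`τ⁻²(f₁ + f₂)² < f₂(y)² + T F*₁(y)`. [cite: Ozanski2017NSISingular, §5.5 (5.29) Case 1] -/
theorem gain_case_one {μ ε τ T B Fx Fy f₁ f₂ fy : ℝ} (hμ : 100 ≤ μ) (hε : 0 < ε) (hτ : τ = 12 / 25 * ε)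
    (hT : T * (112 / 100 * ε ^ 2 * B) = μ ^ 2 - 5) (hT0 : 0 ≤ T) (hFy : 8 * B ≤ Fy)
    (hf₁ : 0 ≤ f₁) (hf₁' : f₁ ≤ μ / 100) (hf₂ : 0 ≤ f₂) (hf₂' : f₂ ≤ μ) :
    τ⁻¹ ^ 2 * (f₁ + f₂) ^ 2 < fy ^ 2 + T * (0 * Fx + 1 * Fy) := by
  have hτpos : 0 < τ := by rw [hτ]; positivity
  have hsum : (f₁ + f₂) ^ 2 ≤ (101 / 100 * μ) ^ 2 := by nlinarith
  have hTF : T * (8 * B) ≤ T * Fy := mul_le_mul_of_nonneg_left hFy hT0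
  have hτ2 : τ⁻¹ ^ 2 = 1 / ((12 / 25) ^ 2 * ε ^ 2) := by rw [hτ]; field_simp
  -- `T (8B) = 8(μ² - 5)/(1.12 ε²)`
  have hT8 : T * (8 * B) * ((112 / 100) * ε ^ 2) = 8 * (μ ^ 2 - 5) := by nlinarith [hT]
  have key : 1 / ((12 / 25) ^ 2 * ε ^ 2) * (101 / 100 * μ) ^ 2 < T * (8 * B) := by
    rw [div_mul_eq_mul_div, one_mul, div_lt_iff₀ (by positivity)]
    nlinarith [hT8, sq_nonneg ε, mul_pos (pow_pos hε 2) (show (0:ℝ) < 1 from one_pos)]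
  calc τ⁻¹ ^ 2 * (f₁ + f₂) ^ 2 ≤ 1 / ((12 / 25) ^ 2 * ε ^ 2) * (101 / 100 * μ) ^ 2 := by
        rw [hτ2]; exact mul_le_mul_of_nonneg_left hsum (by positivity)
    _ < T * (8 * B) := key
    _ ≤ fy ^ 2 + T * (0 * Fx + 1 * Fy) := by nlinarith [sq_nonneg fy]

/-- **(6.7), Case 2** ((5.29) Case 2: `0.01TB ≥ (0.009/1.1)(μ/ε)² > (0.01/0.48)²(μ/ε)²`): if
`F*₁(y) ≥ B/100`, `v₂(y) = (0,1)`, `f₂(R⁻¹x) = 0`, `f₁ ≤ μ/100`, then `τ⁻² f₁² < f₂(y)² + T F*₁(y)`.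
[cite: Ozanski2017NSISingular, §5.5 (5.29) Case 2] -/
theorem gain_case_two {μ ε τ T B Fx Fy f₁ fy : ℝ} (hμ : 100 ≤ μ) (hε : 0 < ε) (hτ : τ = 12 / 25 * ε)
    (hT : T * (112 / 100 * ε ^ 2 * B) = μ ^ 2 - 5) (hT0 : 0 ≤ T) (hFy : B / 100 ≤ Fy)
    (hf₁ : 0 ≤ f₁) (hf₁' : f₁ ≤ μ / 100) :
    τ⁻¹ ^ 2 * (f₁ + 0) ^ 2 < fy ^ 2 + T * (0 * Fx + 1 * Fy) := by
  have hτpos : 0 < τ := by rw [hτ]; positivity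
  have hsum : (f₁ + 0) ^ 2 ≤ (μ / 100) ^ 2 := by nlinarith
  have hTF : T * (B / 100) ≤ T * Fy := mul_le_mul_of_nonneg_left hFy hT0
  have hτ2 : τ⁻¹ ^ 2 = 1 / ((12 / 25) ^ 2 * ε ^ 2) := by rw [hτ]; field_simp
  have hT8 : T * (B / 100) * ((112 / 100) * ε ^ 2) = (μ ^ 2 - 5) / 100 := by nlinarith [hT]
  have key : 1 / ((12 / 25) ^ 2 * ε ^ 2) * (μ / 100) ^ 2 < T * (B / 100) := by
    rw [div_mul_eq_mul_div, one_mul, div_lt_iff₀ (by positivity)]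
    nlinarith [hT8, sq_nonneg ε, mul_pos (pow_pos hε 2) (show (0:ℝ) < 1 from one_pos)]
  calc τ⁻¹ ^ 2 * (f₁ + 0) ^ 2 ≤ 1 / ((12 / 25) ^ 2 * ε ^ 2) * (μ / 100) ^ 2 := by
        rw [hτ2]; exact mul_le_mul_of_nonneg_left hsum (by positivity)
    _ < T * (B / 100) := key
    _ ≤ fy ^ 2 + T * (0 * Fx + 1 * Fy) := by nlinarith [sq_nonneg fy]

end Gain

/-! ### Closures of the rectangular ring -/

/-- `closure (V ∖ W̄) ⊆ V̄ ∖ W` for the rectangular ring `U₂ = V ∖ W̄` (`W` the open rectangle of the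
same bounds as `W̄`). [folklore] -/
theorem closure_ring_subset (R₁ R₂ Z₁ Z₂ r₁ r₂ z₁ z₂ : ℝ) :
    closure (rect R₁ R₂ Z₁ Z₂ \ crect r₁ r₂ z₁ z₂) ⊆ crect R₁ R₂ Z₁ Z₂ \ rect r₁ r₂ z₁ z₂ := by
  intro q hq
  refine ⟨closure_rect_subset _ _ _ _ (closure_mono sdiff_subset hq), fun hqW => ?_⟩
  rw [mem_closure_iff_nhds] at hq
  obtain ⟨p, hp, hpA⟩ := hq _ ((isOpen_rect _ _ _ _).mem_nhds hqW)
  exact hpA.2 (rect_subset_crect _ _ _ _ hp)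

/-! ### The choice of `ε` (5.14), (6.35)–(6.36) -/

section Parameters

/-- A real threshold is eventually exceeded by the naturals: the `m` of the construction. [folklore] -/
theorem exists_nat_ge_all (t : Fin 11 → ℝ) : ∃ m : ℕ, 1 ≤ m ∧ ∀ i, t i < m := by
  refine ⟨⌈∑ i, |t i|⌉₊ + 1, by omega, fun i => ?_⟩
  have h1 : t i ≤ ∑ j, |t j| := (le_abs_self (t i)).trans
    (Finset.single_le_sum (f := fun j => |t j|) (fun j _ => abs_nonneg _) (Finset.mem_univ i))
  have h2 : (∑ j, |t j|) ≤ (⌈∑ j, |t j|⌉₊ : ℝ) := Nat.le_ceil _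
  push_cast
  linarith

/-- **The choice of the main parameter `ε`** (Ożański 2017, (5.14) and §6.5 Step 3 with
(6.35)–(6.36)): `ε = κE/(4Xm)`, `r = E/ε`, `d = κr`, `M = m + 1` (so that `M = 1 + d/(4X)` is an
integer), with `m ∈ ℕ` so large that `ε ≤ 1/20`, `K'ε ≤ 0.96`, `κ/ε ≥ N`, `r ≥ 20|A|`, `r ≥ 10`,
`ε²M ≤ BE⁴/(2·10⁶C)`, `τ^ξ M ≥ 1` for `τ = 0.48ε`, and the four "`d` large" inequalities used in
Steps 4–6. [cite: Ozanski2017NSISingular, §5.3 (5.14) and §6.5 Step 3 (6.35)–(6.36)] -/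
theorem exists_parameters {ξ E κ K' N A Z₀ B C X : ℝ} (hξ0 : 0 < ξ) (hξ1 : ξ < 1) (hE : 0 < E)
    (hκ : 10 ^ 4 ≤ κ) (hB : 0 < B) (hC : 0 < C) (hX : 0 < X) :
    ∃ (m : ℕ) (ε r d : ℝ), 1 ≤ m ∧ 0 < ε ∧ ε = κ * E / (4 * X * m) ∧ r = E / ε ∧ d = κ * r ∧
      ε ≤ 1 / 20 ∧ K' * ε ≤ 96 / 100 ∧ N ≤ κ / ε ∧ 20 * |A| ≤ r ∧ 10 ≤ r ∧
      ε ^ 2 * ((m : ℝ) + 1) ≤ B * E ^ 4 / (2 * 10 ^ 6 * C) ∧ 1 ≤ (12 / 25 * ε) ^ ξ * ((m : ℝ) + 1) ∧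
      |A| + 48 / 100 * κ * E ≤ 3 / 4 * d - r ∧ |A| + 48 / 100 * E ≤ 52 / 100 * d - r ∧
      48 / 100 * E * (1 + κ) + |A| + 1 ≤ 23 / 100 * d ∧ Z₀ < 3 / 4 * d - r ∧
      (m : ℝ) * X = d / 4 := by
  set c₀ : ℝ := κ * E / (4 * X) with hc₀
  have hκ0 : 0 < κ := lt_of_lt_of_le (by norm_num) hκ
  have hc₀pos : 0 < c₀ := by positivity
  set thr : ℝ := B * E ^ 4 / (2 * 10 ^ 6 * C) with hthr
  have hthr0 : 0 < thr := by positivity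
  -- the exponent threshold for `τ^ξ M ≥ 1`
  set b : ℝ := ((12 / 25 * c₀) ^ (-ξ)) with hb
  have hbpos : 0 < b := Real.rpow_pos_of_pos (by positivity) _
  set m₇ : ℝ := b ^ (1 / (1 - ξ)) with hm₇
  have hm₇pos : 0 < m₇ := Real.rpow_pos_of_pos hbpos _
  -- slopes of `r` and `d` in `m`: `r = (E/c₀) m`, `d = κ (E/c₀) m`
  set sr : ℝ := E / c₀ with hsr
  have hsr0 : 0 < sr := by positivity
  have h34 : 0 < 3 / 4 * κ * sr - sr := by nlinarith
  have h52 : 0 < 52 / 100 * κ * sr - sr := by nlinarith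
  obtain ⟨m, hm1, hm⟩ := exists_nat_ge_all ![20 * c₀, K' * c₀ / (96 / 100), |N| * c₀ / κ,
    20 * |A| / sr, 10 / sr, 2 * c₀ ^ 2 / thr, m₇, (|A| + 48 / 100 * κ * E) / (3 / 4 * κ * sr - sr),
    (|A| + 48 / 100 * E) / (52 / 100 * κ * sr - sr), (48 / 100 * E * (1 + κ) + |A| + 1) / (23 / 100 * κ * sr),
    |Z₀| / (3 / 4 * κ * sr - sr)]
  have hmpos : (0 : ℝ) < m := by exact_mod_cast hm1
  have hm1' : (1 : ℝ) ≤ m := by exact_mod_cast hm1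
  set ε : ℝ := c₀ / m with hε
  have hεpos : 0 < ε := by positivity
  have hr : E / ε = sr * m := by rw [hε, hsr]; field_simp
  refine ⟨m, ε, E / ε, κ * (E / ε), hm1, hεpos, by rw [hε, hc₀]; field_simp, rfl, rfl,
    ?_, ?_, ?_, ?_, ?_, ?_, ?_, ?_, ?_, ?_, ?_, ?_⟩
  · -- `ε ≤ 1/20`
    have h := hm 0; simp at h
    rw [hε, div_le_iff₀ hmpos]; linarith
  · -- `K' ε ≤ 0.96`
    have h := hm 1; simp at h
    rw [hε, mul_div_assoc', div_le_iff₀ hmpos]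
    rw [div_lt_iff₀ (by norm_num : (0:ℝ) < 96 / 100)] at h
    linarith
  · -- `N ≤ κ/ε`
    have h := hm 2; simp at h
    rw [hε, div_div_eq_mul_div, le_div_iff₀ hc₀pos]
    rw [div_lt_iff₀ hκ0] at h
    have := le_abs_self N
    nlinarith
  · -- `20 |A| ≤ r`
    have h := hm 3; simp at h
    rw [hr]; rw [div_lt_iff₀ hsr0] at h; linarith
  · -- `10 ≤ r`
    have h := hm 4; simp at h
    rw [hr]; rw [div_lt_iff₀ hsr0] at h; linarith
  · -- `ε² (m+1) ≤ thr`
    have h := hm 5; simp at h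
    rw [div_lt_iff₀ hthr0] at h
    have hm2 : (m : ℝ) + 1 ≤ 2 * m := by linarith
    calc ε ^ 2 * ((m : ℝ) + 1) ≤ ε ^ 2 * (2 * m) := mul_le_mul_of_nonneg_left hm2 (sq_nonneg ε)
      _ = 2 * c₀ ^ 2 / m := by rw [hε]; field_simp
      _ ≤ thr := by rw [div_le_iff₀ hmpos]; linarith
  · -- `τ^ξ M ≥ 1`
    have h := hm 6; simp at h
    have hmm₇ : m₇ ≤ m := h.le
    have h1 : (12 / 25 * ε) ^ ξ = (12 / 25 * c₀) ^ ξ * (m : ℝ) ^ (-ξ) := by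
      rw [hε, show 12 / 25 * (c₀ / m) = 12 / 25 * c₀ / m by ring,
        Real.div_rpow (by positivity) hmpos.le, Real.rpow_neg hmpos.le, div_eq_mul_inv]
    have h2 : (m : ℝ) ^ (1 - ξ) ≤ (m : ℝ) ^ (-ξ) * ((m : ℝ) + 1) := by
      rw [Real.rpow_sub hmpos, Real.rpow_one, Real.rpow_neg hmpos.le, div_eq_mul_inv, mul_comm]
      have : 0 < ((m : ℝ) ^ ξ)⁻¹ := inv_pos.2 (Real.rpow_pos_of_pos hmpos ξ)
      nlinarith
    have h3 : b ≤ (m : ℝ) ^ (1 - ξ) := by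
      have h1ξ : (0 : ℝ) < 1 - ξ := by linarith
      calc b = m₇ ^ (1 - ξ) := by
            rw [hm₇, one_div, Real.rpow_inv_rpow hbpos.le h1ξ.ne']
        _ ≤ (m : ℝ) ^ (1 - ξ) := Real.rpow_le_rpow hm₇pos.le hmm₇ h1ξ.le
    have h4 : (12 / 25 * c₀) ^ ξ * b = 1 := by
      rw [hb, ← Real.rpow_add (by positivity), add_neg_cancel, Real.rpow_zero]
    have h5 : 0 ≤ (12 / 25 * c₀) ^ ξ := Real.rpow_nonneg (by positivity) _
    calc (1 : ℝ) = (12 / 25 * c₀) ^ ξ * b := h4.symm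
      _ ≤ (12 / 25 * c₀) ^ ξ * ((m : ℝ) ^ (-ξ) * ((m : ℝ) + 1)) :=
          mul_le_mul_of_nonneg_left (h3.trans h2) h5
      _ = (12 / 25 * ε) ^ ξ * ((m : ℝ) + 1) := by rw [h1]; ring
  · -- `|A| + 0.48 κ E ≤ 3/4 d - r`
    have h := hm 7; simp at h
    rw [div_lt_iff₀ h34] at h
    rw [hr]; nlinarith
  · have h := hm 8; simp at h
    rw [div_lt_iff₀ h52] at h
    rw [hr]; nlinarith
  · have h := hm 9; simp at h
    rw [div_lt_iff₀ (by positivity)] at h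
    rw [hr]; nlinarith
  · have h := hm 10; simp at h
    rw [div_lt_iff₀ h34] at h
    rw [hr]; have := le_abs_self Z₀; nlinarith
  · -- `m X = d/4`
    rw [hr, hsr, hc₀]; field_simp

end Parameters

/-! ### The arrangement -/

/-- **Fact C′ modulo the cut-offs of Theorem 3.4**: given Ożański's two edge-effect cut-off facts
(`Ozanski2017_cutoff_rect`, `Ozanski2017_cutoff_ring`), for every `ξ ∈ (0,1)` there is a geometric
arrangement for Theorem 14 with `τ^ξ M ≥ 1` (Ożański 2017, §6.5 Steps 1–6 over §5; Scheffer 1987,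
§4). The construction: the base structure on `U = (1/8,7/8) × (-1,1)` from the symmetric base field
and the recipe (Step 1), the stack `H` (§5.2), `κ = 10⁴ max(1,K) max(1, C/D)`, the strip `E`, `X`
with (6.33), `ε = κE/(4Xm)`, `r = E/ε`, `d = κr`, `M = m + 1`, `τ = 0.48ε` (Step 3), the `M`
clusters and the background copy `U^{a,r}`, `a = -κr/ε`, `s²/r = 1.04(κ/ε)⁴B/D` (Step 4), the ring
`U₂` with the field `v₂` of Lemma 5.2 and `f₂ = μ ≥ 100‖f₁‖_∞` on `supp v₂`,
`T = (μ² - 5)/(1.12ε²B)`, `z = (εr/2, 0, A)` (Steps 5–6).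
[cite: Ozanski2017NSISingular, §6.5 Steps 1–6] [cite: Scheffer1987, §4 and (5.1)–(5.7), (5.19)–(5.25)] -/
theorem nsiCantorArrangementExists_of_cutoffs (h34r : Ozanski2017_cutoff_rect)
    (h34g : Ozanski2017_cutoff_ring) : NSICantorArrangementExists := by
  intro ξ hξ0 hξ1
  /- Step 1: the base structure on `U₀ = (1/8, 7/8) × (-1, 1)` and the stack. -/
  obtain ⟨μ₀, hμ₀, hvμ₀⟩ := BaseField.exists_sq_lt
  obtain ⟨f₀, φ₀, h₀, -, -, -, hf₀sym⟩ := exists_structure_rect h34r (by norm_num : (0 : ℝ) < 1 / 8)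
    (by norm_num : (1 / 8 : ℝ) < 7 / 8) (by norm_num : (-1 : ℝ) < 1) BaseField.contDiff_field
    BaseField.tsupport_field_subset_rect (fun q _ => BaseField.div_field q) hμ₀ hvμ₀
  have hf₀ : ∀ q : ℝ × ℝ, f₀ (q.1, -q.2) = f₀ q := fun q => by
    simpa using hf₀sym q.1 q.2
  have hodd := pressureInteraction_snd_axis_odd (v := BaseField.field) (f := f₀) BaseField.field_fst_reflect
    BaseField.field_snd_reflect hf₀
  have hU₀cl : ∀ q ∈ closure (rect (1 / 8) (7 / 8) (-1) 1), ((1 : ℝ) / 8 ≤ q.1 ∧ q.1 ≤ 7 / 8) ∧ |q.2| ≤ 1 := by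
    intro q hq
    have h := closure_rect_subset _ _ _ _ hq
    rw [mem_crect] at h
    exact ⟨h.1, abs_le.2 h.2⟩
  obtain ⟨A, B, C, α₁, ρ₁, σ₁, α₂, ρ₂, σ₂, hB, hC, -, -, -, -, hρ₂, -, -, -, -, -, -, -, -,
    hdec, hst, hstcl, -, -, -, hiii, hstrip⟩ :=
    exists_interactionStack h₀ (fun q hq => (hU₀cl q hq).1) hodd BaseField.exists_field_snd_ne_zero
  have hF₀d : Differentiable ℝ (pressureInteraction BaseField.field f₀) :=
    h₀.contDiff_pressureInteraction.differentiable (by simp)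
  have haxis := h₀.pressureInteraction_fst_axis
  -- the axial extent `Z₀` of the cluster
  obtain ⟨Z₀, hclZ⟩ : ∃ Z₀ : ℝ, ∀ q ∈ closure (stackSet (rect (1 / 8) (7 / 8) (-1) 1) α₁ ρ₁ α₂ ρ₂),
      (ρ₂ / 8 ≤ q.1 ∧ q.1 ≤ 7 / 8) ∧ |q.2| ≤ Z₀ := by
    obtain ⟨R₀, hR₀⟩ := hst.isCompact_closure.isBounded.exists_norm_le
    exact ⟨R₀, fun q hq => ⟨hstcl q hq, ((Real.norm_eq_abs _).symm.le.trans (norm_snd_le q)).trans (hR₀ q hq)⟩⟩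
  /- The constants `D, K, κ`, Lemma 3.5 (v), the strip `E` and the period `X`. -/
  have hDpos := h₀.interactionLimit_pos BaseField.exists_field_snd_ne_zero
  obtain ⟨K, hKpos, hring⟩ := exists_ringField
  obtain ⟨K', hK'1, hKK'⟩ : ∃ K' : ℝ, 1 ≤ K' ∧ K ≤ K' := ⟨max 1 K, le_max_left _ _, le_max_right _ _⟩
  have hK'pos : 0 < K' := lt_of_lt_of_le one_pos hK'1
  obtain ⟨κ, hκ4, hκCD⟩ : ∃ κ : ℝ, 10 ^ 4 ≤ κ ∧
      34 * (C / (9 / (4 * π) * ∫ y : ℝ³, (BaseField.field (meridian y)).2 ^ 2)) * (1 / κ) ≤ 34 / (10 ^ 4 * K') := by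
    set D : ℝ := 9 / (4 * π) * ∫ y : ℝ³, (BaseField.field (meridian y)).2 ^ 2
    have hCD : 0 ≤ C / D := div_nonneg hC.le hDpos.le
    have hm : C / D ≤ max 1 (C / D) := le_max_right _ _
    have hm0 : 1 ≤ max 1 (C / D) := le_max_left _ _
    refine ⟨10 ^ 4 * K' * max 1 (C / D), by nlinarith only [hK'1, hm0], ?_⟩
    rw [mul_one_div, div_le_div_iff₀ (by positivity) (by positivity)]
    nlinarith only [hCD, hm, hm0, hK'pos]
  have hκpos : 0 < κ := lt_of_lt_of_le (by norm_num) hκ4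
  obtain ⟨N, -, hnear⟩ := h₀.pressureInteraction_snd_near_axis (κ + 1)
    (ε := (9 / (4 * π) * ∫ y : ℝ³, (BaseField.field (meridian y)).2 ^ 2) / 1000) (by positivity)
  obtain ⟨E, hE, hEρ, hE2, hv5, hvi6⟩ := hstrip κ hκpos
  obtain ⟨X, hX2Z, hXAκ, hXCB⟩ : ∃ X : ℝ, 2 * Z₀ < X ∧ 4 * |A| + 2 * (κ * E) + 1 ≤ X ∧ 10600 * C / B + 1 ≤ X :=
    ⟨max (max (2 * Z₀ + 1) (4 * |A| + 2 * (κ * E) + 1)) (10600 * C / B + 1),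
      lt_of_lt_of_le (by linarith only) ((le_max_left _ _).trans (le_max_left _ _)),
      (le_max_right _ _).trans (le_max_left _ _), le_max_right _ _⟩
  have hCB : 0 ≤ 10600 * C / B := by positivity
  have hX1 : 1 ≤ X := by linarith only [hXCB, hCB]
  have hXpos : 0 < X := by linarith only [hX1]
  have hκE : 0 < κ * E := mul_pos hκpos hE
  have hAnn : 0 ≤ |A| := abs_nonneg A
  have hX4A : 4 * |A| ≤ X := by linarith only [hXAκ, hκE]
  have hXκ : 2 * |A| + 2 * (κ * E) ≤ X := by linarith only [hXAκ, hAnn]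
  have hXt : 10600 * C / B ≤ X ^ 4 := by
    have := le_self_pow₀ hX1 (by norm_num : (4 : ℕ) ≠ 0); linarith only [this, hXCB]
  /- Step 3: the parameters. -/
  obtain ⟨m, ε, r, d, hm1, hε, hεdef, hrdef, hddef, hε20, hK'ε, hNε, hr20A, hr10, hεM, hτξ, hg1, hg2, hg3, hg4,
    hmX⟩ := exists_parameters (N := N) (A := A) (Z₀ := Z₀) (K' := K') hξ0 hξ1 hE hκ4 hB hC hXpos
  have hm1' : (1 : ℝ) ≤ m := by exact_mod_cast hm1
  have hrpos : 0 < r := by linarith only [hr10]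
  have hεr : ε * r = E := by rw [hrdef]; field_simp
  have hεrpos : 0 < ε * r := by rw [hεr]; exact hE
  have hε2 : ε ≤ 1 / 2 := by linarith only [hε20]
  have hd4r : 4 * r ≤ d := by rw [hddef]; nlinarith only [hκ4, hrpos]
  have hrd : r ≤ d := by linarith only [hd4r, hrpos]
  have hdpos : 0 < d := by linarith only [hd4r, hrpos]
  have hMreal : (((m + 1 : ℕ)) : ℝ) = (m : ℝ) + 1 := by push_cast; ring
  have hMX : (((m + 1 : ℕ) : ℝ) - 1) * X = d / 4 := by rw [hMreal]; linarith only [hmX]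
  have hnX : ∀ n ∈ Finset.range (m + 1), (0 : ℝ) ≤ n * X ∧ (n : ℝ) * X ≤ d / 4 := fun n hn => by
    have h1 := Finset.mem_range.1 hn
    have h2 : (n : ℝ) + 1 ≤ ((m + 1 : ℕ) : ℝ) := by exact_mod_cast h1
    have h3 : (n : ℝ) ≤ m := by rw [hMreal] at h2; linarith only [h2]
    exact ⟨mul_nonneg (Nat.cast_nonneg n) hXpos.le, by nlinarith only [h3, hXpos, hmX]⟩
  have hτpos : 0 < 12 / 25 * ε := by positivity
  have hτd : 12 / 25 * ε * d = 48 / 100 * κ * E := by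
    rw [hddef, show 12 / 25 * ε * (κ * r) = 12 / 25 * κ * (ε * r) by ring, hεr]; ring
  have hτr : 12 / 25 * ε * r = 48 / 100 * E := by
    rw [show 12 / 25 * ε * r = 12 / 25 * (ε * r) by ring, hεr]; ring
  -- the background copy: `a = -κr/ε = -d/ε`, `s²/r = 1.04 (κ/ε)⁴ B/D`
  have hdε : 2 * d ≤ d / ε := by rw [le_div_iff₀ hε]; nlinarith only [hε2, hdpos]
  have ha : -(κ * r / ε) = -(d / ε) := by rw [hddef]
  have hτa : 12 / 25 * ε * -(κ * r / ε) = -(48 / 100 * d) := by rw [hddef]; field_simp; norm_num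
  have har' : -(κ * r / ε) + r < -d := by rw [ha]; linarith only [hdε, hd4r, hrpos]
  have hZd : Z₀ < d := by linarith only [hg4, hdpos, hrpos]
  have har : -(κ * r / ε) + r < -Z₀ := by linarith only [har', hZd]
  obtain ⟨s, hspos, hssq⟩ : ∃ s : ℝ, 0 < s ∧ s ^ 2 / r = 104 / 100 * (κ / ε) ^ 4 * B /
      (9 / (4 * π) * ∫ y : ℝ³, (BaseField.field (meridian y)).2 ^ 2) := by
    refine ⟨Real.sqrt (104 / 100 * (κ / ε) ^ 4 * B * r / (9 / (4 * π) * ∫ y : ℝ³, (BaseField.field (meridian y)).2 ^ 2)),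
      Real.sqrt_pos.2 (by positivity), ?_⟩
    rw [Real.sq_sqrt (by positivity)]; field_simp
  /- Step 4: the first structure. -/
  obtain ⟨-, -, hccl⟩ := hst.clusters hclZ hX2Z (m + 1)
  obtain ⟨h₁, hF₁, hbgcl⟩ := hst.clusters_add_background h₀ hclZ hX2Z (m + 1) hU₀cl hrpos hspos har
  obtain ⟨Mf, hMf⟩ := h₁.exists_f_le
  obtain ⟨μ, hμ100, hf₁μ⟩ : ∃ μ : ℝ, 100 ≤ μ ∧ ∀ q,
      (clusterFun (stackFun f₀ α₁ ρ₁ σ₁ α₂ ρ₂ σ₂) (m + 1) X + copyFun (-(κ * r / ε)) r s f₀) q ≤ μ / 100 :=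
    ⟨100 * max Mf 1, by nlinarith only [le_max_right Mf 1], fun q => by linarith only [hMf q, le_max_left Mf 1]⟩
  have hμpos : 0 < μ := by linarith only [hμ100]
  obtain ⟨T, hTeq, hTpos⟩ : ∃ T : ℝ, T * (112 / 100 * ε ^ 2 * B) = μ ^ 2 - 5 ∧ 0 < T := by
    refine ⟨(μ ^ 2 - 5) / (112 / 100 * ε ^ 2 * B), by field_simp, div_pos ?_ (by positivity)⟩
    nlinarith only [hμ100]
  /- The ring field and the second structure. -/
  obtain ⟨hwc, hwdiv, hwsupp, hwrect, hw1, hw2, hw3, hw4⟩ := hring ε r d hε hε20 hrpos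
  have hw4' : ∀ q : ℝ × ℝ, |(RingField.field ε r d q).1| ≤ K' * ε := fun q =>
    (hw4 q).trans (mul_le_mul_of_nonneg_right hKK' hε.le)
  have hwsq : ∀ q : ℝ × ℝ, (RingField.field ε r d q).1 ^ 2 + (RingField.field ε r d q).2 ^ 2 < μ ^ 2 := fun q => by
    have h1 : |(RingField.field ε r d q).1| ≤ 96 / 100 := (hw4' q).trans hK'ε
    have h3 := hw3 q
    have h2 : |(RingField.field ε r d q).2| ≤ 1 := abs_le.2 ⟨by nlinarith only [h3.1, hε20, hε], h3.2⟩
    have h1' := sq_le_sq.2 ((abs_of_nonneg (by norm_num : (0:ℝ) ≤ 96 / 100)).symm ▸ h1)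
    have h2' := sq_le_sq.2 ((abs_of_nonneg (by norm_num : (0:ℝ) ≤ 1)).symm ▸ h2)
    nlinarith only [h1', h2', hμ100]
  obtain ⟨f₂, φ₂, h₂, hf₂μ, hf₂le, hf₂nn⟩ := exists_structure_ring h34g (R₁ := ε * r / 200) (R₂ := r)
    (Z₁ := -d) (Z₂ := d) (r₁ := ε * r) (r₂ := r / 10) (z₁ := -(d - r)) (z₂ := d - r) (by positivity)
    (by linarith only [hεrpos]) (by linarith only [mul_le_mul_of_nonneg_right hε20 hrpos.le, hrpos]) (by linarith only [hrpos])
    (by linarith only [hrpos]) (by linarith only [hd4r, hrpos]) (by linarith only [hrpos]) hwc hwsupp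
    (fun q _ => hwdiv q) hμpos hwsq
  have hU₂cl : ∀ q ∈ closure (rect (ε * r / 200) r (-d) d \ crect (ε * r) (r / 10) (-(d - r)) (d - r)),
      (0 ≤ q.1 ∧ q.1 ≤ r) ∧ |q.2| ≤ d ∧ q ∉ rect (ε * r) (r / 10) (-(d - r)) (d - r) := by
    intro q hq
    have h := closure_ring_subset _ _ _ _ _ _ _ _ hq
    rw [Set.mem_sdiff, mem_crect] at h
    exact ⟨⟨by linarith only [h.1.1.1, hεrpos], h.1.1.2⟩, abs_le.2 h.1.2, h.2⟩
  /- Analytic inputs on the first interaction function `F* = H* + F^{a,r,s}`. -/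
  have hs1 : ∀ p : ℝ × ℝ, 0 ≤ p.1 → p.1 < ε * r → -(102 / 100) * B ≤
      (hstar (pressureInteraction (stackVec BaseField.field α₁ ρ₁ σ₁ α₂ ρ₂ σ₂) (stackFun f₀ α₁ ρ₁ σ₁ α₂ ρ₂ σ₂))
        (m + 1) X p).2 := by
    intro p hp0 hpE
    rw [hεr] at hpE
    exact hstar_snd_ge_strip hB hC.le hX4A hX1 hXt hiii hv5 (m + 1) hp0 hpE
  have hsbox : ∀ n : ℕ, n < m + 1 → ∀ p : ℝ × ℝ, |p.2 - (A + n * X)| ≤ κ * E → 0 ≤ p.1 → p.1 < ε * r →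
      (698 / 100) * B ≤ (hstar (pressureInteraction (stackVec BaseField.field α₁ ρ₁ σ₁ α₂ ρ₂ σ₂)
        (stackFun f₀ α₁ ρ₁ σ₁ α₂ ρ₂ σ₂)) (m + 1) X p).2 := by
    intro n hn p hpA hp0 hpE
    rw [hεr] at hpE
    exact hstar_snd_ge_box hB hC.le hX4A hX1 hXt hXκ hiii hvi6 hn hpA hp0 hpE
  have hs2 : ∀ p : ℝ × ℝ, (∀ n ∈ Finset.range (m + 1), r / 10 ≤ ‖(p.1, p.2 - n * X)‖) →
      ‖hstar (pressureInteraction (stackVec BaseField.field α₁ ρ₁ σ₁ α₂ ρ₂ σ₂) (stackFun f₀ α₁ ρ₁ σ₁ α₂ ρ₂ σ₂))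
        (m + 1) X p‖ ≤ B * ε ^ 2 / 100 := by
    intro p hfar
    have h1 := norm_hstar_le (X := X) hC.le (by positivity : (0 : ℝ) < r / 10) (by linarith only [hr20A]) hiii hfar
    refine h1.trans ?_
    rw [hMreal]
    have hr4 : r ^ 4 = E ^ 4 / ε ^ 4 := by rw [hrdef, div_pow]
    have key : ((m : ℝ) + 1) * (2 * C / (r / 10) ^ 4) = 2 * 10 ^ 4 * C * (ε ^ 2 * ((m : ℝ) + 1)) * ε ^ 2 / E ^ 4 := by
      rw [div_pow, hr4]; field_simp
    rw [key, div_le_div_iff₀ (by positivity) (by norm_num)]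
    have h2 := mul_le_mul_of_nonneg_left hεM (by positivity : (0 : ℝ) ≤ 2 * 10 ^ 4 * C * ε ^ 2 * 100)
    have e : 2 * 10 ^ 4 * C * ε ^ 2 * 100 * (B * E ^ 4 / (2 * 10 ^ 6 * C)) = B * ε ^ 2 * E ^ 4 := by
      field_simp; norm_num
    rw [e] at h2
    linarith only [h2]
  have hb : ∀ p : ℝ × ℝ, 0 ≤ p.1 → p.1 ≤ 99 / 100 * r → |p.2| ≤ d →
      ((s ^ 2 / r) • pressureInteraction BaseField.field f₀ (copyInv (-(κ * r / ε)) r p)).2 ∈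
          Set.Icc (103 / 100 * B) (105 / 100 * B) ∧
        |((s ^ 2 / r) • pressureInteraction BaseField.field f₀ (copyInv (-(κ * r / ε)) r p)).1| ≤
          34 * ε * B / (10 ^ 4 * K') := by
    intro p hp0 hp1 hp2
    rw [hddef] at hp2
    constructor
    · rw [Prod.smul_snd, smul_eq_mul, hssq]
      exact background_snd_mem hB hDpos hκpos hε hrpos hnear hNε hp0 hp1 hp2
    · rw [Prod.smul_fst, smul_eq_mul, hssq]
      refine (background_fst_le hB hC.le hDpos hκpos hε hε2 hrpos hF₀d (fun q hq => (hdec q hq).2)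
        haxis hp0 hp1 hp2).trans ?_
      calc 34 * (C / (9 / (4 * π) * ∫ y : ℝ³, (BaseField.field (meridian y)).2 ^ 2)) * (ε / κ) * B
          = 34 * (C / (9 / (4 * π) * ∫ y : ℝ³, (BaseField.field (meridian y)).2 ^ 2)) * (1 / κ) * (ε * B) := by
            ring
        _ ≤ 34 / (10 ^ 4 * K') * (ε * B) := mul_le_mul_of_nonneg_right hκCD (by positivity)
        _ = 34 * ε * B / (10 ^ 4 * K') := by ring
  -- the decomposition `F* = H* + F^{a,r,s}`, pointwise
  have hF₁' := fun p => congrFun hF₁ p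
  -- `F*₁ ≥ 0.01B` on the strip part of `BOX`, `≥ 8B` on the boxes `SBOX_n`
  have hF01 : ∀ y : ℝ × ℝ, 0 ≤ y.1 → y.1 < ε * r → |y.2| ≤ d →
      B / 100 ≤ (pressureInteraction (clusterVec (stackVec BaseField.field α₁ ρ₁ σ₁ α₂ ρ₂ σ₂) (m + 1) X +
        copyVec (-(κ * r / ε)) r s BaseField.field) (clusterFun (stackFun f₀ α₁ ρ₁ σ₁ α₂ ρ₂ σ₂) (m + 1) X +
        copyFun (-(κ * r / ε)) r s f₀) y).2 := by
    intro y hy0 hyE hyd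
    rw [hF₁', Prod.snd_add]
    have h1 := hs1 y hy0 hyE
    have h2 := (hb y hy0 (by nlinarith only [hyE, hε20, hrpos]) hyd).1
    linarith only [h1, h2.1]
  have hF8 : ∀ (n : ℕ), n < m + 1 → ∀ y : ℝ × ℝ, 0 ≤ y.1 → y.1 < ε * r → |y.2| ≤ d → |y.2 - (A + n * X)| ≤ κ * E →
      8 * B ≤ (pressureInteraction (clusterVec (stackVec BaseField.field α₁ ρ₁ σ₁ α₂ ρ₂ σ₂) (m + 1) X +
        copyVec (-(κ * r / ε)) r s BaseField.field) (clusterFun (stackFun f₀ α₁ ρ₁ σ₁ α₂ ρ₂ σ₂) (m + 1) X +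
        copyFun (-(κ * r / ε)) r s f₀) y).2 := by
    intro n hn y hy0 hyE hyd hyA
    rw [hF₁', Prod.snd_add]
    have h1 := hsbox n hn y hyA hy0 hyE
    have h2 := (hb y hy0 (by nlinarith only [hyE, hε20, hrpos]) hyd).1
    linarith only [h1, h2.1, hB]
  /- Step 5: the point `z` and the axial coordinates on `G`. -/
  have hGz : ∀ x ∈ revolve (closure (clusterSet (stackSet (rect (1 / 8) (7 / 8) (-1) 1) α₁ ρ₁ α₂ ρ₂) (m + 1) X ∪
        copySet (-(κ * r / ε)) r (rect (1 / 8) (7 / 8) (-1) 1)) ∪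
      closure (rect (ε * r / 200) r (-d) d \ crect (ε * r) (r / 10) (-(d - r)) (d - r))),
      |x 2| ≤ d ∨ (-(κ * r / ε) - r ≤ x 2 ∧ x 2 ≤ -(κ * r / ε) + r) := by
    intro x hx
    rw [mem_revolve, closure_union, Set.union_assoc, Set.mem_union] at hx
    have hx2 : (meridian x).2 = x 2 := rfl
    rcases hx with hx | hx | hx
    · left
      obtain ⟨-, n, hn, hnz⟩ := hccl _ hx
      have h := hnX n hn
      rw [← hx2, abs_le]; rw [abs_le] at hnz
      constructor <;> linarith only [hnz.1, hnz.2, h.1, h.2, hg4, hrpos, hdpos]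
    · exact Or.inr (hbgcl _ hx).2
    · exact Or.inl ((hU₂cl _ hx).2.1)
  refine ⟨clusterSet (stackSet (rect (1 / 8) (7 / 8) (-1) 1) α₁ ρ₁ α₂ ρ₂) (m + 1) X ∪
      copySet (-(κ * r / ε)) r (rect (1 / 8) (7 / 8) (-1) 1),
    rect (ε * r / 200) r (-d) d \ crect (ε * r) (r / 10) (-(d - r)) (d - r),
    clusterVec (stackVec BaseField.field α₁ ρ₁ σ₁ α₂ ρ₂ σ₂) (m + 1) X + copyVec (-(κ * r / ε)) r s BaseField.field,
    clusterFun (stackFun f₀ α₁ ρ₁ σ₁ α₂ ρ₂ σ₂) (m + 1) X + copyFun (-(κ * r / ε)) r s f₀,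
    clusterFun (stackFun φ₀ α₁ ρ₁ 1 α₂ ρ₂ 1) (m + 1) X + copyFun (-(κ * r / ε)) r 1 φ₀,
    RingField.field ε r d, f₂, φ₂, T, 12 / 25 * ε, m + 1, X, meridianPoint (ε * r / 2, A), ?_, ?_⟩
  · -- `τ^ξ M ≥ 1`
    rw [hMreal]; exact hτξ
  refine
    { structure₁ := h₁
      structure₂ := h₂
      disjoint_closure := ?_
      nonempty := ?_
      T_pos := hTpos
      τ_mem := ⟨hτpos, by linarith only [hε20]⟩
      M_pos := Nat.succ_pos m
      X_pos := hXpos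
      z_apply_one := by simp
      τ_mul_lt_one := ?_
      disjoint_image := ?_
      sq_lt := ?_
      gain := ?_ }
  · -- `Ū₁ ∩ Ū₂ = ∅`
    rw [closure_union]
    refine disjoint_left.2 ?_
    rintro q (hq | hq) hq₂
    · obtain ⟨⟨hq1, hq2⟩, n, hn, hnz⟩ := hccl _ hq
      obtain ⟨-, -, hhole⟩ := hU₂cl _ hq₂
      apply hhole
      rw [mem_rect]
      have h := hnX n hn
      rw [abs_le] at hnz
      exact ⟨⟨by linarith only [hεr, hEρ, hq1], by linarith only [hq2, hr10]⟩,
        by linarith only [hnz.1, h.1, hg4, hdpos], by linarith only [hnz.2, h.2, hg4]⟩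
    · obtain ⟨-, hz, -⟩ := hU₂cl _ hq₂
      have := (hbgcl _ hq).2.2
      linarith only [(abs_le.1 hz).1, this, har']
  · -- `U₁ ≠ ∅`: the point `(1/2, 0)` of `U₀` lies in the first cluster
    refine ⟨((1 : ℝ) / 2, 0), Or.inl ?_⟩
    rw [clusterSet]
    simp only [mem_iUnion, Finset.mem_range]
    refine ⟨0, Nat.succ_pos m, ?_⟩
    rw [mem_copySet]
    simp only [CharP.cast_eq_zero, zero_mul, copyInv_apply, div_one, sub_zero]
    rw [stackSet]
    left; left
    rw [mem_rect]; norm_num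
  · -- `τ M < 1`
    rw [hMreal]
    have h1 : ε * ((m : ℝ) + 1) ≤ 2 * (ε * m) := by nlinarith only [hm1', hε]
    have h2 : ε * m = κ * E / (4 * X) := by rw [hεdef]; field_simp
    have h3 : κ * E / (4 * X) ≤ 1 / 8 := by
      rw [div_le_iff₀ (by positivity)]; linarith only [hXκ, hAnn]
    linarith only [h1, h2, h3]
  · -- (6.3): the `Γ_n(G)` are pairwise disjoint
    refine pairwise_disjoint_images (d := d) (a := -(κ * r / ε)) (r := r) hτpos hXpos hGz ?_ ?_ ?_ _
    · rw [hτd]; linarith only [hXκ, hκE, hAnn]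
    · rw [hτr]; linarith only [hX1, hE2]
    · rw [hMX, mul_add, hτa, hτr, hτd]; linarith only [hg3, hAnn]
  · -- (6.6)
    intro q hq
    refine sq_lt_of_inner (K' := K') (fun hq' => ?_) (hf₂μ q) (h₂.f_pos hq) (hw3 q) (hw4' q) hε20 hε hK'ε hTeq hTpos.le
    exact inner_ge (M := m + 1) hε hε20 hrpos hd4r hB hK'1 hK'ε hXpos hMX hF₁' hw1 hw2 hw3 hw4' hs1 hs2 hb
      (RingField.tsupport_field_subset_carrier hε hε20 hrpos hq')
  · -- (6.7)
    intro x hx n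
    obtain ⟨hy1, hy2⟩ := meridian_image (z₂ := A) (X := X) hτpos (by positivity : (0 : ℝ) ≤ ε * r / 2) x (m + 1) n
    -- abbreviations for the two meridian points
    set q := meridian x with hq
    set y := meridian ((12 / 25 * ε) • x + cantorTranslate X (meridianPoint (ε * r / 2, A)) (m + 1) n) with hy
    have hqx : cylRadius x = q.1 := rfl
    have hx2 : x 2 = q.2 := rfl
    rw [hqx] at hy1
    rw [hx2] at hy2
    have hnlt : (n : ℕ) < m + 1 := n.isLt
    have hnXb := hnX n (Finset.mem_range.2 hnlt)
    have hq0 : 0 ≤ q.1 := cylRadius_nonneg x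
    have hf₁0 := h₁.f_nonneg q
    have hf₁q := hf₁μ q
    rw [mem_revolve, closure_union, Set.union_assoc, Set.mem_union] at hx
    -- Case split: `R⁻¹x` in `BOX` (clusters or `Ū₂`), or in the background copy
    have hbox : (q.1 ≤ r ∧ |q.2| ≤ d) ∨ q ∈ closure (copySet (-(κ * r / ε)) r (rect (1 / 8) (7 / 8) (-1) 1)) := by
      rcases hx with hx | hx | hx
      · left
        obtain ⟨⟨-, hq2⟩, k, hk, hkz⟩ := hccl _ hx
        have h := hnX k hk
        rw [abs_le] at hkz
        exact ⟨by linarith only [hq2, hr10], abs_le.2 ⟨by linarith only [hkz.1, h.1, hg4, hrpos, hdpos], by linarith only [hkz.2, h.2, hg4, hrpos]⟩⟩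
      · exact Or.inr hx
      · exact Or.inl ⟨(hU₂cl _ hx).1.2, (hU₂cl _ hx).2.1⟩
    rcases hbox with ⟨hq1, hq2⟩ | hbg
    · -- Case 1: `y ∈ SBOX_n`
      have hy1' := abs_le.1 hy1
      have hτq : 12 / 25 * ε * q.1 ≤ 48 / 100 * E := by rw [← hτr]; exact mul_le_mul_of_nonneg_left hq1 hτpos.le
      have hy0 : 0 ≤ y.1 := by linarith only [hy1'.1, hτq, hεr, hE]
      have hyE : y.1 < ε * r := by linarith only [hy1'.2, hτq, hεr, hE]
      have hyrect : y.1 ∈ Set.Icc (2 * ε * r / 100) (98 * ε * r / 100) :=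
        ⟨by linarith only [hy1'.1, hτq, hεr], by linarith only [hy1'.2, hτq, hεr]⟩
      have hτq2 : |12 / 25 * ε * q.2| ≤ 48 / 100 * κ * E := by
        rw [abs_mul, abs_of_pos hτpos, ← hτd]; exact mul_le_mul_of_nonneg_left hq2 hτpos.le
      have hyA : |y.2 - (A + (n : ℕ) * X)| ≤ κ * E := by
        rw [hy2, show 12 / 25 * ε * q.2 + A + (n : ℕ) * X - (A + (n : ℕ) * X) = 12 / 25 * ε * q.2 by ring]
        linarith only [hτq2, hκE]
      have hyz : |y.2| ≤ d - r := by
        rw [hy2, abs_le]; have h := abs_le.1 hτq2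
        constructor <;> linarith only [h.1, h.2, hnXb.1, hnXb.2, hg1, neg_abs_le A, le_abs_self A]
      have hyd : |y.2| ≤ d := hyz.trans (by linarith only [hrpos])
      have hwy := hwrect y hyz hyrect
      have hFy := hF8 n hnlt y hy0 hyE hyd hyA
      rw [hwy]
      have hf₂q : f₂ q ≤ μ := hf₂le q
      exact gain_case_one (Fx := _) hμ100 hε rfl hTeq hTpos.le hFy hf₁0 hf₁q (hf₂nn q) hf₂q
    · -- Case 2: `R⁻¹x` in the background copy: `y ∈ RECT`, left of `SBOX₁`
      obtain ⟨⟨hq1a, hq1b⟩, hq2a, hq2b⟩ := hbgcl _ hbg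
      have hf₂q : f₂ q = 0 := by
        refine h₂.f_eq_zero fun h' => ?_
        have := (abs_le.1 (hU₂cl _ h').2.1).1
        linarith only [this, hq2b, har']
      have hy1' := abs_le.1 hy1
      have hτq : 12 / 25 * ε * q.1 ≤ 7 / 8 * (48 / 100 * E) := by
        rw [← hτr]; nlinarith only [hq1b, hτpos]
      have hy0 : 0 ≤ y.1 := by linarith only [hy1'.1, hτq, hεr, hE]
      have hyE : y.1 < ε * r := by linarith only [hy1'.2, hτq, hεr, hE]
      have hyrect : y.1 ∈ Set.Icc (2 * ε * r / 100) (98 * ε * r / 100) :=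
        ⟨by linarith only [hy1'.1, hτq, hεr, hE], by linarith only [hy1'.2, hτq, hεr, hE]⟩
      have hlo : 12 / 25 * ε * (-(κ * r / ε) - r) ≤ 12 / 25 * ε * q.2 := mul_le_mul_of_nonneg_left hq2a hτpos.le
      have hhi : 12 / 25 * ε * q.2 ≤ 12 / 25 * ε * (-(κ * r / ε) + r) := mul_le_mul_of_nonneg_left hq2b hτpos.le
      rw [mul_sub, hτa, hτr] at hlo
      rw [mul_add, hτa, hτr] at hhi
      have hyz : |y.2| ≤ d - r := by
        rw [hy2, abs_le]
        constructor <;> linarith only [hlo, hhi, hnXb.1, hnXb.2, hg2, hg3, hκE, neg_abs_le A, le_abs_self A, hd4r, hrpos]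
      have hyd : |y.2| ≤ d := hyz.trans (by linarith only [hrpos])
      have hwy := hwrect y hyz hyrect
      have hFy := hF01 y hy0 hyE hyd
      rw [hwy, hf₂q]
      exact gain_case_two (Fx := _) hμ100 hε rfl hTeq hTpos.le hFy hf₁0 hf₁q

/-- **Fact C′ holds once the two cut-off facts hold** (packaging for the day
`Ozanski2017_cutoff_rect_holds` and `Ozanski2017_cutoff_ring_holds` land: then
`NSICantorArrangementExists_holds := nsiCantorArrangementExists_of_cutoffs ‹_› ‹_›`).
[cite: Ozanski2017NSISingular, §6.5] -/
theorem nsiCantorBlockExists_of_cutoffs (h34r : Ozanski2017_cutoff_rect) (h34g : Ozanski2017_cutoff_ring)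
    (hD : NSICantorBlock_of_arrangement) : NSICantorBlockExists :=
  nsiCantorBlockExists_of_arrangement (nsiCantorArrangementExists_of_cutoffs h34r h34g) hD

end Literature.Barriers.NavierStokesRegularity
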